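import Mathlib
import Summits.Ventures.HodgeRepro2.Hypothesis
import Summits.Ventures.HodgeRepro2.ReflexPos
import Summits.Ventures.HodgeRepro2.PicardExists
import Summits.Ventures.HodgeRepro2.ReflexFieldEq
import Summits.Ventures.HodgeRepro2.T5AutExtension

/-!
# The reflex field of the Picard datum is `τ₁(K)` for a Galois CM field

`Hypothesis.lean` records the reflex field of the Hodge-type datum `(Φ, H)` as
`reflexField K Φ H = ⨅ σ ∈ hodgeStabilizer K Φ H, Fix(σ)`, where `hodgeType K Φ H τ` is `p` at
the chosen embedding of a place and `q` at the other one, for the signature `(p, q)` of `H` at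
that place, and `ReflexFieldEqImage K Φ H τ₁` is the shape «`reflexField = τ₁(K)`».
`ReflexFieldEq.lean` proved the reduced version (`reducedSig`, the negative index only). Here the
full shape is proved for a **Galois** CM field `K` and a Picard signature of rank `n + 1 ≥ 3`:

* `fieldRange_eq_of_isGalois`: all complex embeddings of a Galois number field have the same
  image (Mathlib's `AlgHom.fieldRange_of_normal`).
* `hodgeType_eq`: under `IsPicardSignaturePos`, `hodgeType` takes the value `n` at the chosen
  embedding `τ* = Φ.emb (mk τ₁)`, `1` at the other embedding of that place, and `n + 1` / `0` at
  the chosen / other embedding of every other place.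
* `hodgeStabilizer_subset_fixingSet` (`n ≥ 2`: the value `n` is taken only at `τ*`, so a
  stabilising automorphism fixes `τ*(K)`), `fixingSet_subset_hodgeStabilizer` (Galois),
  **`hodgeStabilizer_eq`**, **`reflexField_eq_fieldRange`** (by `T5AutExtension.iInf_eqLocusField_eq`),
  **`reflexFieldEqImage`**.

Not claimed: the non-Galois case. There the stabiliser can be smaller than the fixing set of
`τ*(K)` (an automorphism fixing `τ*(K)` may move the other embeddings), the reflex field is the
reflex field of the CM type and can be larger than `τ₁(K)`; the shape `ReflexFieldEqImage` as
filed needs the Galois hypothesis (or a finer analysis). Everything stated is proved; no new axioms.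
-/

namespace Summit.Ventures.HodgeRepro2.ShimuraData

open NumberField

section Galois

variable {K : Type*} [Field K] [NumberField K]

/-- All complex embeddings of a Galois number field have the same image. -/
theorem fieldRange_eq_of_isGalois [IsGalois ℚ K] (τ τ' : K →+* ℂ) :
    τ.fieldRange = τ'.fieldRange := by
  have hN : Normal ℚ τ'.toRatAlgHom.fieldRange :=
    Normal.of_algEquiv (F := ℚ) (E := K) τ'.toRatAlgHom.equivFieldRange
  have key := @AlgHom.fieldRange_of_normal ℚ ℂ _ _ _ τ'.toRatAlgHom.fieldRange hN
    (τ.toRatAlgHom.comp τ'.toRatAlgHom.equivFieldRange.symm.toAlgHom)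
  have h1 : (τ.toRatAlgHom.comp τ'.toRatAlgHom.equivFieldRange.symm.toAlgHom).fieldRange =
      τ.toRatAlgHom.fieldRange := by
    ext z
    simp only [AlgHom.mem_fieldRange, AlgHom.comp_apply]
    constructor
    · rintro ⟨x, rfl⟩
      exact ⟨_, rfl⟩
    · rintro ⟨x, rfl⟩
      exact ⟨τ'.toRatAlgHom.equivFieldRange x, by simp⟩
  have h2 : τ.toRatAlgHom.fieldRange = τ'.toRatAlgHom.fieldRange := h1.symm.trans key
  have h3 := congrArg IntermediateField.toSubfield h2
  simpa using h3

/-- An automorphism of `ℂ` fixing the image of one embedding of a Galois number field fixes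
every embedding. -/
theorem comp_eq_of_mem_fixingSet_of_isGalois [IsGalois ℚ K] {σ : ℂ ≃+* ℂ} {τ' : K →+* ℂ}
    (hσ : σ ∈ fixingSet τ'.fieldRange) (τ : K →+* ℂ) : (σ : ℂ →+* ℂ).comp τ = τ := by
  rw [comp_eq_iff_mem_fixingSet, fieldRange_eq_of_isGalois τ τ']
  exact hσ

end Galois

section HodgeType

open scoped Classical

variable {K : Type*} [Field K] [NumberField K] [NumberField.IsCMField K]
variable {n : ℕ} {τ₁ : K →+* ℂ} {H : Matrix (Fin (n + 1)) (Fin (n + 1)) K}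

/-- The signature of a hermitian form at a conjugate embedding. -/
theorem signatureAt_conjugate' (hH : IsHermitianForm K H) (τ : K →+* ℂ) :
    signatureAt K (ComplexEmbedding.conjugate τ) H = signatureAt K τ H :=
  signatureAt_conjugate K hH τ

/-- The value of `hodgeType` at every embedding, under `IsPicardSignaturePos`. -/
theorem hodgeType_eq (hH : IsHermitianForm K H) (hP : IsPicardSignaturePos K τ₁ H)
    (Φ : CMTypeChoice K) (τ : K →+* ℂ) :
    hodgeType K Φ H τ =
      if InfinitePlace.mk τ = InfinitePlace.mk τ₁ then (if Φ.emb (InfinitePlace.mk τ) = τ then n else 1)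
      else (if Φ.emb (InfinitePlace.mk τ) = τ then n + 1 else 0) := by
  unfold hodgeType
  by_cases hτ : InfinitePlace.mk τ = InfinitePlace.mk τ₁
  · have hsig : signatureAt K τ H = (n, 1) := by
      rcases InfinitePlace.mk_eq_iff.1 hτ with h | h
      · rw [h]
        exact hP.1
      · rw [← signatureAt_conjugate' hH τ, h]
        exact hP.1
    rw [if_pos hτ, hsig]
  · have hsig : signatureAt K τ H = (n + 1, 0) := hP.2 τ hτ
    rw [if_neg hτ, hsig]

/-- For `n ≥ 2`, an automorphism stabilising the Hodge types fixes the chosen embedding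
`τ* = Φ.emb (mk τ₁)` pointwise. -/
theorem hodgeStabilizer_subset_fixingSet (hH : IsHermitianForm K H)
    (hP : IsPicardSignaturePos K τ₁ H) (hn : 2 ≤ n) (Φ : CMTypeChoice K) :
    hodgeStabilizer K Φ H ⊆ fixingSet (Φ.emb (InfinitePlace.mk τ₁)).fieldRange := by
  intro σ hσ
  rw [← comp_eq_iff_mem_fixingSet]
  have hmk : InfinitePlace.mk (Φ.emb (InfinitePlace.mk τ₁)) = InfinitePlace.mk τ₁ := Φ.emb_mk _
  have hval : hodgeType K Φ H (Φ.emb (InfinitePlace.mk τ₁)) = n := by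
    rw [hodgeType_eq hH hP, if_pos hmk, if_pos (by rw [hmk])]
  have h1 := hσ (Φ.emb (InfinitePlace.mk τ₁))
  rw [hval, hodgeType_eq hH hP] at h1
  split_ifs at h1 with hm hc hc
  · rw [hm] at hc
    exact hc.symm
  · omega
  · omega
  · omega

omit [NumberField.IsCMField K] in
/-- For a Galois `K`, an automorphism fixing `τ*(K)` stabilises the Hodge types. -/
theorem fixingSet_subset_hodgeStabilizer [IsGalois ℚ K] (Φ : CMTypeChoice K) :
    fixingSet (Φ.emb (InfinitePlace.mk τ₁)).fieldRange ⊆ hodgeStabilizer K Φ H := by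
  intro σ hσ τ
  rw [comp_eq_of_mem_fixingSet_of_isGalois hσ τ]

/-- **The Hodge-type stabiliser is the fixing set of `τ*(K)`** (Galois `K`, `n ≥ 2`). -/
theorem hodgeStabilizer_eq [IsGalois ℚ K] (hH : IsHermitianForm K H)
    (hP : IsPicardSignaturePos K τ₁ H) (hn : 2 ≤ n) (Φ : CMTypeChoice K) :
    hodgeStabilizer K Φ H = fixingSet (Φ.emb (InfinitePlace.mk τ₁)).fieldRange :=
  Set.Subset.antisymm (hodgeStabilizer_subset_fixingSet hH hP hn Φ)
    (fixingSet_subset_hodgeStabilizer Φ)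

/-- **The reflex field of the Picard datum is `τ*(K)`** (Galois `K`, `n ≥ 2`). -/
theorem reflexField_eq_fieldRange [IsGalois ℚ K] (hH : IsHermitianForm K H)
    (hP : IsPicardSignaturePos K τ₁ H) (hn : 2 ≤ n) (Φ : CMTypeChoice K) :
    reflexField K Φ H = (Φ.emb (InfinitePlace.mk τ₁)).fieldRange := by
  unfold reflexField
  rw [hodgeStabilizer_eq hH hP hn Φ]
  haveI := countable_fieldRange (Φ.emb (InfinitePlace.mk τ₁))
  exact T5AutExtension.iInf_eqLocusField_eq _

/-- **`ReflexFieldEqImage` holds for a Galois CM field** and a Picard signature of rank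
`n + 1 ≥ 3`: the reflex field is `τ₁(K)`. -/
theorem reflexFieldEqImage [IsGalois ℚ K] (hH : IsHermitianForm K H)
    (hP : IsPicardSignaturePos K τ₁ H) (hn : 2 ≤ n) (Φ : CMTypeChoice K) :
    ReflexFieldEqImage K Φ H τ₁ := by
  unfold ReflexFieldEqImage
  rw [reflexField_eq_fieldRange hH hP hn Φ]
  exact fieldRange_eq_of_isGalois _ _

end HodgeType

end Summit.Ventures.HodgeRepro2.ShimuraData
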